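import Summits.FinalStateConjecture.FinalStateConjecture.Theorems.EIHFluxBalanceInertialRecessionStubEndgameClusters
import Summits.FinalStateConjecture.FinalStateConjecture.Theorems.EIHFluxBalanceInertialRecessionStubEndgameIsolated

/-!
# Route EIHFluxBalance — crux `InertialRecession`, line `sublinear-is-free-clean-window-charges`:
# the increment oracle for TIGHT member sets (one admissible window path)

Helper file for the crux `stmt-FinalStateConjecture-10166`
(`Summit.FinalStateConjecture.FinalStateConjecture.Theses.EIHFluxBalance.InertialRecession`), registered stub
`stub_pairwiseDichotomy` (lead reshape r7) of `Cruxes/InertialRecession/Lines/sublinear_is_free_clean_window_charges.lean`.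

The oracle series (`…Oracle{Cross,SlowGroup,Top}`) reduces the abstract endgame, for every `N`, to an INCREMENT ORACLE: bounds
on the change of `Σ_S Mⱼγⱼvⱼ` and `Σ_S Mⱼγⱼ` for slow, ballistically isolated member sets. This file supplies the oracle's basic
instance from the WINDOW LAW + IDENTIFICATION: `increment_of_windowPath` — if along `[t₁,t₂]` a member set `A` with reference member
`a` stays within `R/2` of `ξ_a` while every non-member stays beyond `3R/2`, for an input radius `R` (2-Lipschitz, `ρ ≤ R/2`,
`‖ξ_a‖ + R ≤ (κ+κ²)s/2`), then the path `(ξ_a, R)` is admissible with `δ = 1/2` and the landed `cluster_increment` bounds the energy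
and each momentum component of `A` by `C∫R^{-3/2} + ζ(t₁) + ζ(t₂)`; `norm_increment_of_windowPath` packages the momentum VECTOR
(`≤ 3×` the componentwise bound). This is the "tight set" case (singletons always; any set spatially clustered relative to its
outsiders); the general oracle writes a slow class as finitely many tight pieces (lead's roadmap §4/§7).
-/

noncomputable section

set_option linter.dupNamespace false

open Filter Topology Set MeasureTheory intervalIntegral
open scoped Topology BigOperators

namespace Summit.FinalStateConjecture.FinalStateConjecture.Theorems.SublinearIsFree.Oracle

open Literature.Geometry.Lorentzian
open Summit.FinalStateConjecture.FinalStateConjecture.Theorems.SublinearIsFree.Endgame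

/-- **INCREMENT ALONG AN EXPLICIT WINDOW PATH (tight member set).** Instances of the window law (`C`, after `T`) and of the
identification (`ζ`, after `T'`) for the threshold `ρ` and clearance `δ = 1/2`; centres with speed `≤ 2` after `T₀`; a member set
`A ∋ a` and a radius function `R` on `[t₁,t₂]` (2-Lipschitz, positive, `ρ ≤ R/2`, `‖ξ_a‖ + R ≤ (κ+κ²)s/2`, members within `R/2` of
`ξ_a`, non-members beyond `3R/2`). Then the energy and the momentum components of `A` change by at most
`C∫R^{-3/2} + ζ(t₁) + ζ(t₂)`. [folklore] -/
theorem increment_of_windowPath {N : ℕ} (M : Fin N → ℝ) (ξ v : Fin N → ℝ → E3) (κ : ℝ) (P : ℝ → E3 → ℝ → Fin 4 → ℝ)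
    (ρ : ℝ → ℝ) (C T T' T₀ : ℝ) (ζ : ℝ → ℝ)
    (hWL : ∀ (t₁ t₂ : ℝ) (c : ℝ → E3) (R : ℝ → ℝ), T ≤ t₁ → t₁ ≤ t₂ →
      (∀ s ∈ Set.Icc t₁ t₂, ∀ s' ∈ Set.Icc t₁ t₂, ‖c s - c s'‖ ≤ 2 * |s - s'| ∧ |R s - R s'| ≤ 2 * |s - s'|) →
      (∀ s ∈ Set.Icc t₁ t₂, ρ s ≤ (1 / 2) * R s ∧ ‖c s‖ + R s ≤ (κ + κ ^ 2) / 2 * s ∧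
        ∀ j, ‖ξ j s - c s‖ ≤ (1 - 1 / 2) * R s ∨ (1 + 1 / 2) * R s ≤ ‖ξ j s - c s‖) →
      ∀ μ : Fin 4, |P t₂ (c t₂) (R t₂) μ - P t₁ (c t₁) (R t₁) μ| ≤ C * ∫ s in t₁..t₂, (R s ^ (3 / 2 : ℝ))⁻¹)
    (hID : ∀ (t : ℝ) (c : E3) (R : ℝ) (A : Finset (Fin N)), T' ≤ t → ρ t ≤ (1 / 2) * R →
      ‖c‖ + R ≤ (κ + κ ^ 2) / 2 * t →
      (∀ j, ‖ξ j t - c‖ ≤ (1 - 1 / 2) * R ∨ (1 + 1 / 2) * R ≤ ‖ξ j t - c‖) →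
      (∀ j, j ∈ A ↔ ‖ξ j t - c‖ ≤ (1 - 1 / 2) * R) →
      |P t c R 0 - ∑ j ∈ A, M j * (√(1 - ‖v j t‖ ^ 2))⁻¹| ≤ ζ t ∧
      ∀ k : Fin 3, |P t c R k.succ - ∑ j ∈ A, M j * (√(1 - ‖v j t‖ ^ 2))⁻¹ * v j t k| ≤ ζ t)
    (hdiff : ∀ i, Differentiable ℝ (ξ i)) (hspeed : ∀ i s, T₀ ≤ s → ‖deriv (ξ i) s‖ ≤ 2)
    {A : Finset (Fin N)} {a : Fin N} {t₁ t₂ : ℝ} {R : ℝ → ℝ}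
    (hT : T ≤ t₁) (hT' : T' ≤ t₁) (hT₀ : T₀ ≤ t₁) (h12 : t₁ ≤ t₂)
    (hRlip : ∀ s ∈ Set.Icc t₁ t₂, ∀ s' ∈ Set.Icc t₁ t₂, |R s - R s'| ≤ 2 * |s - s'|)
    (hRpos : ∀ s ∈ Set.Icc t₁ t₂, 0 < R s) (hρ : ∀ s ∈ Set.Icc t₁ t₂, ρ s ≤ R s / 2)
    (hcap : ∀ s ∈ Set.Icc t₁ t₂, ‖ξ a s‖ + R s ≤ (κ + κ ^ 2) / 2 * s)
    (hmem : ∀ s ∈ Set.Icc t₁ t₂, ∀ i ∈ A, ‖ξ i s - ξ a s‖ ≤ R s / 2)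
    (hnon : ∀ s ∈ Set.Icc t₁ t₂, ∀ j ∉ A, 3 * R s / 2 ≤ ‖ξ j s - ξ a s‖) :
    |∑ j ∈ A, M j * (√(1 - ‖v j t₂‖ ^ 2))⁻¹ - ∑ j ∈ A, M j * (√(1 - ‖v j t₁‖ ^ 2))⁻¹| ≤
        C * (∫ s in t₁..t₂, (R s ^ (3 / 2 : ℝ))⁻¹) + ζ t₁ + ζ t₂ ∧
    ∀ k : Fin 3, |∑ j ∈ A, M j * (√(1 - ‖v j t₂‖ ^ 2))⁻¹ * v j t₂ k - ∑ j ∈ A, M j * (√(1 - ‖v j t₁‖ ^ 2))⁻¹ * v j t₁ k| ≤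
        C * (∫ s in t₁..t₂, (R s ^ (3 / 2 : ℝ))⁻¹) + ζ t₁ + ζ t₂ := by
  classical
  -- the path `c = ξ a` is 2-Lipschitz after `T₀`
  have hlip : ∀ s ∈ Set.Icc t₁ t₂, ∀ s' ∈ Set.Icc t₁ t₂,
      ‖ξ a s - ξ a s'‖ ≤ 2 * |s - s'| ∧ |R s - R s'| ≤ 2 * |s - s'| := fun s hs s' hs' ↦
    ⟨lipschitz_two_of_deriv (hdiff a) (fun t ht ↦ hspeed a t ht) (hT₀.trans hs.1) (hT₀.trans hs'.1), hRlip s hs s' hs'⟩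
  -- admissibility with `δ = 1/2`
  have hadm : ∀ s ∈ Set.Icc t₁ t₂, ρ s ≤ (1 / 2) * R s ∧ ‖ξ a s‖ + R s ≤ (κ + κ ^ 2) / 2 * s ∧
      ∀ j, ‖ξ j s - ξ a s‖ ≤ (1 - 1 / 2) * R s ∨ (1 + 1 / 2) * R s ≤ ‖ξ j s - ξ a s‖ := by
    intro s hs
    refine ⟨by linarith [hρ s hs], hcap s hs, fun j ↦ ?_⟩
    by_cases hj : j ∈ A
    · left; have := hmem s hs j hj; linarith
    · right; have := hnon s hs j hj; linarith
  -- membership at the two ends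
  have hA : ∀ s ∈ Set.Icc t₁ t₂, ∀ j, j ∈ A ↔ ‖ξ j s - ξ a s‖ ≤ (1 - 1 / 2) * R s := by
    intro s hs j
    constructor
    · intro hj; have := hmem s hs j hj; linarith
    · intro h
      by_contra hj
      have := hnon s hs j hj
      have := hRpos s hs
      linarith
  exact cluster_increment M ξ v κ P ρ (1 / 2) C T T' ζ hWL hID hT hT' h12 hlip hadm
    (hA t₁ (Set.left_mem_Icc.mpr h12)) (hA t₂ (Set.right_mem_Icc.mpr h12))

/-- The momentum VECTOR of a member set from its three identified components: if each component of
`Σ_A Mⱼγⱼvⱼ` changes by at most `B` then the vector changes by at most `3B`. [folklore] -/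
theorem norm_momentum_sub_le_of_components {N : ℕ} (A : Finset (Fin N)) (M : Fin N → ℝ) (w₁ w₂ : Fin N → E3) {B : ℝ}
    (h : ∀ k : Fin 3, |∑ j ∈ A, M j * (√(1 - ‖w₂ j‖ ^ 2))⁻¹ * w₂ j k - ∑ j ∈ A, M j * (√(1 - ‖w₁ j‖ ^ 2))⁻¹ * w₁ j k| ≤ B) :
    ‖∑ j ∈ A, (M j * (√(1 - ‖w₂ j‖ ^ 2))⁻¹) • w₂ j - ∑ j ∈ A, (M j * (√(1 - ‖w₁ j‖ ^ 2))⁻¹) • w₁ j‖ ≤ 3 * B := by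
  calc ‖∑ j ∈ A, (M j * (√(1 - ‖w₂ j‖ ^ 2))⁻¹) • w₂ j - ∑ j ∈ A, (M j * (√(1 - ‖w₁ j‖ ^ 2))⁻¹) • w₁ j‖
      ≤ ∑ k, |(∑ j ∈ A, (M j * (√(1 - ‖w₂ j‖ ^ 2))⁻¹) • w₂ j - ∑ j ∈ A, (M j * (√(1 - ‖w₁ j‖ ^ 2))⁻¹) • w₁ j) k| :=
        norm_le_sum_abs _
    _ ≤ ∑ _k : Fin 3, B := by
        refine Finset.sum_le_sum fun k _ ↦ ?_
        have hk := h k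
        have heq : (∑ j ∈ A, (M j * (√(1 - ‖w₂ j‖ ^ 2))⁻¹) • w₂ j - ∑ j ∈ A, (M j * (√(1 - ‖w₁ j‖ ^ 2))⁻¹) • w₁ j) k =
            ∑ j ∈ A, M j * (√(1 - ‖w₂ j‖ ^ 2))⁻¹ * w₂ j k - ∑ j ∈ A, M j * (√(1 - ‖w₁ j‖ ^ 2))⁻¹ * w₁ j k := by
          simp only [PiLp.sub_apply, WithLp.ofLp_sum, Finset.sum_apply, PiLp.smul_apply, smul_eq_mul]
        rw [heq]; exact hk
    _ = 3 * B := by simp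

/-- Registered helper form of `norm_momentum_sub_le_of_components`. [folklore] -/
theorem oracle_norm_momentum_sub_le_of_components : ∀ (N : ℕ) (A : Finset (Fin N)) (M : Fin N → ℝ) (w₁ w₂ : Fin N → E3) (B : ℝ), (∀ k : Fin 3, |∑ j ∈ A, M j * (√(1 - ‖w₂ j‖ ^ 2))⁻¹ * w₂ j k - ∑ j ∈ A, M j * (√(1 - ‖w₁ j‖ ^ 2))⁻¹ * w₁ j k| ≤ B) → ‖∑ j ∈ A, (M j * (√(1 - ‖w₂ j‖ ^ 2))⁻¹) • w₂ j - ∑ j ∈ A, (M j * (√(1 - ‖w₁ j‖ ^ 2))⁻¹) • w₁ j‖ ≤ 3 * B :=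
  fun _ A M w₁ w₂ _ h ↦ norm_momentum_sub_le_of_components A M w₁ w₂ h

end Summit.FinalStateConjecture.FinalStateConjecture.Theorems.SublinearIsFree.Oracle

end
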